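import Summits.BirchSwinnertonDyer.BirchSwinnertonDyer.Theorems.SignedLowerHalvesSmallImageLowerHalfBothSignsRttCharRoadTorsionModule
import Summits.BirchSwinnertonDyer.BirchSwinnertonDyer.Theorems.SignedLowerHalvesSmallImageLowerHalfBothSignsRttCharRoadTorsionWitness
import Literature.NumberTheory.GaloisRepresentations.AbsGaloisGroupCompact
import Mathlib.NumberTheory.Padics.RingHoms
import HarnessLib

/-!
# Route `SignedLowerHalves`, crux L `SmallImageLowerHalfBothSigns` (stmt-BirchSwinnertonDyer-23599), line `rtt_w3` v12 — row T-2 of INJ_top: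
# `hT0` — `W_K[p^∞]` HAS NO NON-ZERO POINT FIXED BY `Gal(K̄/K_∞)`, FOR EVERY `ℤ_p`-EXTENSION `K_∞/K`

Hand `bsd-inputs-honda-p1` g20 (LEAD `cruxlead-stmt-BirchSwinnertonDyer-23599`; the hypothesis `hT0` of width seat `bsd-line-slh-p3-w3` g18's (I6)
`…RttCharRoadE1JointInjectivity.oneCocycleClass_eq_zero_of_forall_comp_eq_zero`); helper `--supports stmt-BirchSwinnertonDyer-23599`;
THEOREMS ONLY (no definition, no named fact, no instance, no `sorry`).  BSD / crux L / INJ_top are NOT proved here.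

For the crux pair `(W, p)` and the quadratic `K` with `v = (p)` inert, `Γ_{K_v}` acts on `W_K[p^∞]` through the Lubin–Tate character `χ_{−p}` ONTO
`𝒪_v^×` by the scalars `u` (`…RttCharRoadTorsionModule.exists_torsionModule`).  For ANY `ℤ_p`-extension `κ : Γ_K ↠ ℤ_p` the image of the compact
`Γ_{K_v}` in `ℤ_p` is closed, hence a `ℤ_p`-submodule, hence divisible by `N := #(𝒪_v/p)^× = p² − 1` (a `p`-adic unit):
★ `exists_mul_pow_of_continuousMonoidHom_padicInt` — every `γ` is `h · γ'^N` with `h` in the kernel.  Taking `γ = δ₁` with `χ(δ₁) = b₀` a unit NOT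
congruent to a rational integer mod `p` (`…TorsionWitness.exists_unit_not_congr_natCast`) gives `h ∈ ker` with `χ(h) ≡ b₀ · (unit)^{−N} ≡ b₀ (mod p)`, so
`χ(h) − 1` is a unit, and a unit-minus-one scalar has no non-zero fixed point (`eq_zero_of_scalar_fixed`, through row J-curve's `α`):
★★ `geomPrimaryTorsion_eq_zero_of_forall_kerSubgroup_smul` = `hT0`.

References: [LubinTate1965] §2 Thm. 2 and Cor.; [SerreLocalFields1979] Ch. XIV §7; [Washington1997] §13.1; [Kobayashi2003] §8.
-/

set_option autoImplicit false
-- D-0017: single-problem summit, the namespace repeats the problem name by design.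
set_option linter.dupNamespace false
noncomputable section

open scoped Classical NumberField
open NumberField IsDedekindDomain Field ValuativeRel IsDedekindDomain.HeightOneSpectrum WeierstrassCurve
  Literature.NumberTheory.EllipticCurves Literature.NumberTheory.EllipticCurves.Kobayashi2003
  Literature.NumberTheory.EllipticCurves.Rank1Residual Literature.NumberTheory.NumberFields
  Literature.NumberTheory.GaloisRepresentations Literature.NumberTheory.GaloisRepresentations.IsNonarchimedeanLocalField
  Literature.NumberTheory.GaloisRepresentations.LubinTate
  Summit.BirchSwinnertonDyer.BirchSwinnertonDyer.Theorems.SmallImageCharSignedSelmer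

namespace Summit.BirchSwinnertonDyer.BirchSwinnertonDyer.Theorems.SmallImageRttCharRoad

section Divisible

variable {p : ℕ} [hp : Fact p.Prime]

/-- ★ **Closed subgroups of `ℤ_p` are divisible by `p`-adic units**: for a continuous homomorphism `φ` from a compact group to `ℤ_p` and `N`
prime to `p`, every `γ` is `h · γ'^N` with `φ h = 1` (the image of `φ` is closed under `ℤ_p`-multiples since `ℕ` is dense in `ℤ_p`).
[cite: Washington1997, §13.1] [cite: SerreLocalFields1979, Ch. XIV §7] -/
theorem exists_mul_pow_of_continuousMonoidHom_padicInt {G : Type*} [Group G] [TopologicalSpace G] [CompactSpace G]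
    (φ : G →ₜ* Multiplicative ℤ_[p]) {N : ℕ} (hN : ¬ p ∣ N) (γ : G) :
    ∃ h γ' : G, φ h = 1 ∧ γ = h * γ' ^ N := by
  set a : ℤ_[p] := Multiplicative.toAdd (φ γ) with ha
  -- the set of `c` with `c • a` in the image is closed and contains `ℕ`
  have hclosed : IsClosed {c : ℤ_[p] | ∃ g : G, Multiplicative.toAdd (φ g) = c * a} := by
    have h1 : {c : ℤ_[p] | ∃ g : G, Multiplicative.toAdd (φ g) = c * a} = (fun c ↦ Multiplicative.ofAdd (c * a)) ⁻¹' Set.range φ := by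
      ext c
      simp only [Set.mem_setOf_eq, Set.mem_preimage, Set.mem_range]
      constructor
      · rintro ⟨g, hg⟩; exact ⟨g, by rw [← hg, ofAdd_toAdd]⟩
      · rintro ⟨g, hg⟩; exact ⟨g, by rw [hg, toAdd_ofAdd]⟩
    rw [h1]
    exact (isCompact_range φ.continuous).isClosed.preimage (continuous_ofAdd.comp (continuous_id.mul continuous_const))
  have hnat : Set.range (Nat.cast : ℕ → ℤ_[p]) ⊆ {c : ℤ_[p] | ∃ g : G, Multiplicative.toAdd (φ g) = c * a} := by
    rintro _ ⟨n, rfl⟩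
    exact ⟨γ ^ n, by rw [map_pow, toAdd_pow, ha, nsmul_eq_mul]⟩
  have hall : ∀ c : ℤ_[p], ∃ g : G, Multiplicative.toAdd (φ g) = c * a := fun c ↦
    (hclosed.closure_subset_iff.mpr hnat) (PadicInt.denseRange_natCast c)
  -- `N` is a `p`-adic unit
  have hNu : IsUnit (N : ℤ_[p]) :=
    PadicInt.isUnit_iff.mpr (le_antisymm (PadicInt.norm_le_one _) (not_lt.mp (mt PadicInt.norm_natCast_lt_one_iff.mp hN)))
  obtain ⟨w, hw⟩ := hNu
  obtain ⟨γ', hγ'⟩ := hall ((w⁻¹ : (ℤ_[p])ˣ) : ℤ_[p])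
  have hpow : φ (γ' ^ N) = φ γ := by
    apply Multiplicative.toAdd.injective
    rw [map_pow, toAdd_pow, hγ', nsmul_eq_mul, ← mul_assoc, ← hw, Units.mul_inv, one_mul]
  refine ⟨γ * (γ' ^ N)⁻¹, γ', ?_, (inv_mul_cancel_right γ (γ' ^ N)).symm⟩
  rw [map_mul, map_inv, hpow, mul_inv_cancel]

end Divisible

section Fixed

variable {K : Type} [Field K] [NumberField K] (v : HeightOneSpectrum (𝓞 K)) {p : ℕ} [hp : Fact p.Prime] {T : Type*} [AddCommGroup T]

/-- **A scalar congruent to a non-trivial residue has no non-zero fixed point**: with `α (u b t) = e_v b • α t`, `α` injective, if `b − 1` is a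
unit of `𝒪[K_v]` then `u b x = x` forces `x = 0`. [folklore] -/
theorem eq_zero_of_scalar_fixed (u : 𝒪[v.adicCompletion K] → (T →+ T))
    (α : T →+ (v.adicCompletion K ⧸ Submodule.span (v.adicCompletionIntegers K) {(1 : v.adicCompletion K)}))
    (hα : Function.Injective α) (hαu : ∀ (b : 𝒪[v.adicCompletion K]) (t : T), α (u b t) = integerEquivAdicCompletionIntegers v b • α t)
    {b : 𝒪[v.adicCompletion K]} (hb : IsUnit (b - 1)) (x : T) (hx : u b x = x) : x = 0 := by
  obtain ⟨w, hw⟩ := hb.map (integerEquivAdicCompletionIntegers v)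
  rw [map_sub, map_one] at hw
  have h1 : (integerEquivAdicCompletionIntegers v b - 1) • α x = 0 := by
    rw [sub_smul, one_smul, ← hαu, hx, sub_self]
  have h2 : α x = 0 := by
    rw [← hw] at h1
    calc α x = ((w⁻¹ : (v.adicCompletionIntegers K)ˣ) : v.adicCompletionIntegers K) • ((w : v.adicCompletionIntegers K) • α x) := by
          rw [smul_smul, Units.inv_mul, one_smul]
      _ = 0 := by rw [h1, smul_zero]
  exact hα (by rw [h2, map_zero])

end Fixed

/-- ★★ **`hT0`: for every `ℤ_p`-extension `K_∞/K`, `W_K[p^∞]^{Gal(K̄/K_∞)} = 0`** (crux pair `(W, p)`, quadratic `K`, `v = (p)` inert). See the module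
docstring. [cite: LubinTate1965, §2 Thm. 2 and Cor.] [cite: Washington1997, §13.1] [cite: Kobayashi2003, §8] -/
theorem geomPrimaryTorsion_eq_zero_of_forall_kerSubgroup_smul :
    ∀ (W : WeierstrassCurve ℚ) [W.IsElliptic] [W.IsGloballyMinimal] (p : ℕ) [Fact p.Prime],
      p ≠ 2 → ClassX7 W p → W.frobeniusTrace p = 0 →
      ∀ (K : Type) [Field K] [NumberField K] (v : HeightOneSpectrum (𝓞 K)),
        Module.finrank ℚ K = 2 → v.asIdeal = Ideal.span {(p : 𝓞 K)} →
      ∀ (κ : ZpExtension K p) (t : (W.baseChange K).geomPrimaryTorsion p),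
        (∀ x : κ.kerSubgroup, (x : absoluteGaloisGroup K) • t = t) → t = 0 := by
  intro W _ _ p _ hp2 hX hap K _ _ v hK2 hv κ t ht
  obtain ⟨-, u, α, -, -, -, -, -, -, -, hgal, hχsurj, -, hαbij, -, hαu⟩ := exists_torsionModule W p hp2 hX hap K v hK2 hv
  have hπu := (isUniformizer_neg_natCast_of_asIdeal_eq_span v hv).1
  -- the residue field `k = 𝒪_v/(p)` and `N = #kˣ = p² − 1`
  have hq := natCard_residueField_adicCompletionIntegers_eq_sq v hK2 hv
  have hpr : Fact p.Prime := inferInstance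
  haveI : Finite (IsLocalRing.ResidueField (v.adicCompletionIntegers K)) :=
    Nat.finite_of_card_ne_zero (by rw [hq]; exact pow_ne_zero _ hpr.out.ne_zero)
  letI : Fintype (IsLocalRing.ResidueField (v.adicCompletionIntegers K)) := Fintype.ofFinite _
  set N := Fintype.card (IsLocalRing.ResidueField (v.adicCompletionIntegers K))ˣ with hNdef
  have hN : ¬ p ∣ N := by
    intro hdvd
    rw [hNdef, Fintype.card_units, ← Nat.card_eq_fintype_card, hq] at hdvd
    have h1 : p ∣ p ^ 2 - (p ^ 2 - 1) := Nat.dvd_sub (dvd_pow_self p two_ne_zero) hdvd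
    rw [Nat.sub_sub_self (Nat.one_le_pow _ _ hpr.out.pos)] at h1
    exact hpr.out.one_lt.ne' (Nat.dvd_one.mp h1)
  -- the residue of a Lubin–Tate value, as a unit of `k`
  set e := integerEquivAdicCompletionIntegers v with hedef
  set r : (𝒪[v.adicCompletion K])ˣ →* (IsLocalRing.ResidueField (v.adicCompletionIntegers K))ˣ :=
    Units.map ((IsLocalRing.residue (v.adicCompletionIntegers K)).toMonoidHom.comp (e : 𝒪[v.adicCompletion K] →* v.adicCompletionIntegers K))
    with hrdef
  have hr : ∀ w : (𝒪[v.adicCompletion K])ˣ, ((r w : (IsLocalRing.ResidueField (v.adicCompletionIntegers K))ˣ) :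
      IsLocalRing.ResidueField (v.adicCompletionIntegers K)) = IsLocalRing.residue (v.adicCompletionIntegers K) (e (w : 𝒪[v.adicCompletion K])) :=
    fun _ ↦ rfl
  -- a unit `b₀` of `𝒪_v` not congruent to a rational integer, realised by `δ₁`
  obtain ⟨b₀, hb₀u, hb₀n⟩ := exists_unit_not_congr_natCast v hK2 hv
  obtain ⟨δ₁, hδ₁⟩ := hχsurj (e.symm b₀) (hb₀u.map _)
  -- divide `δ₁` by an `N`-th power inside the kernel of `κ ∘ res`
  haveI : CompactSpace (absoluteGaloisGroup (v.adicCompletion K)) := absoluteGaloisGroup_compactSpace (v.adicCompletion K)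
  obtain ⟨h, γ', hh, hδ₁eq⟩ := exists_mul_pow_of_continuousMonoidHom_padicInt
    (κ.toContinuousMonoidHom.comp (resGalOfEmb (closureEmb (K := K) (v.adicCompletion K)))) hN δ₁
  have hmem : resGalOfEmb (closureEmb (K := K) (v.adicCompletion K)) h ∈ κ.kerSubgroup := by
    rw [ZpExtension.mem_kerSubgroup]
    exact hh
  -- `h` fixes `t`, i.e. `u (χ h) t = t`
  have hfix : u ((lubinTateChar hπu h : (𝒪[v.adicCompletion K])ˣ) : 𝒪[v.adicCompletion K]) t = t := by
    rw [← hgal]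
    exact ht ⟨_, hmem⟩
  refine eq_zero_of_scalar_fixed v u α hαbij.1 hαu ?_ t hfix
  -- `χ h ≡ b₀ (mod p)`: `χ h = χ δ₁ · (χ γ')^{-N}` and `x^N = 1` in `kˣ`
  have hχh : lubinTateChar hπu h = lubinTateChar hπu δ₁ * ((lubinTateChar hπu γ') ^ N)⁻¹ := by
    have h1 : h = δ₁ * (γ' ^ N)⁻¹ := by rw [hδ₁eq, mul_inv_cancel_right]
    rw [h1, ← lubinTateCharHom_apply, ← lubinTateCharHom_apply, ← lubinTateCharHom_apply, map_mul, map_inv, map_pow]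
  have hres : r (lubinTateChar hπu h) = r (lubinTateChar hπu δ₁) := by
    rw [hχh, map_mul, map_inv, map_pow, hNdef, pow_card_eq_one, inv_one, mul_one]
  have hres' : IsLocalRing.residue (v.adicCompletionIntegers K) (e (lubinTateChar hπu h : 𝒪[v.adicCompletion K])) =
      IsLocalRing.residue (v.adicCompletionIntegers K) b₀ := by
    rw [← hr, hres, hr, hδ₁, hedef, RingEquiv.apply_symm_apply]
  -- hence `e (χ h) - 1 ∉ 𝔪 = (p)`, a unit
  have hunit : IsUnit (e (lubinTateChar hπu h : 𝒪[v.adicCompletion K]) - 1) := by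
    rw [← IsLocalRing.residue_ne_zero_iff_isUnit, map_sub, map_one, hres', ← map_one (IsLocalRing.residue (v.adicCompletionIntegers K)),
      ← map_sub, Ne, IsLocalRing.residue_eq_zero_iff, maximalIdeal_adicCompletionIntegers_eq_span_natCast v hv, Ideal.mem_span_singleton]
    have h1 := hb₀n 1
    rwa [Nat.cast_one] at h1
  have h2 : IsUnit (e ((lubinTateChar hπu h : 𝒪[v.adicCompletion K]) - 1)) := by rwa [map_sub, map_one]
  simpa using h2.map e.symm

end Summit.BirchSwinnertonDyer.BirchSwinnertonDyer.Theorems.SmallImageRttCharRoad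

end
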